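import Summits.ValiantsHypothesis.ValiantsHypothesis.Theses.AnyonJets

/-!
# Route AnyonJets — `Assembly` (stmt-ValiantsHypothesis-16750)

`ConstantFreeJetGrowth → JetConstantElim → UniformJetUpperBound → ValiantsHypothesis` is the route's
deciding theorem `closes`; candidate proof on file (grounder g70-7), landed under Theorems
(prover-only). Honest framing: bookkeeping only.
-/

set_option linter.dupNamespace false

namespace Summit.ValiantsHypothesis.ValiantsHypothesis.Theorems.AnyonJets

open Summit.ValiantsHypothesis.ValiantsHypothesis.Theses.AnyonJets

/-- **Item `Assembly` (stmt-ValiantsHypothesis-16750), PROVED** by `closes`. [folklore] -/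
theorem assembly_proof : Assembly :=
  fun hCF hCE hU => closes hCF hCE hU

end Summit.ValiantsHypothesis.ValiantsHypothesis.Theorems.AnyonJets
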